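import Summits.CriticalPhenomena.PercolationContinuityZ3.Theorems.PercNearOneGluingNoHeavyLowerTailIncStarOneTargetSideMoments
import HarnessLib

/-!
# Two-cuts with the root and one target on the root side (MODE B), X: the moments and the reduced form (R1)

Support file for the Sahi programme (`--supports stmt-CriticalPhenomena-4575`, prover prim-sahi-p2 gen 27).  No definitions, no named
facts, no sorries; standard axioms.  Memo `run/shared/lean/prim/prim-sahi/FROM-prim-sahi-p2-gen25-MODE-B-CONE.md` §1 ((R1)) and §4b ((B1)).

**Setting** (the vocabulary of gen 24's `…IncStarOneTargetSideEvents`, with the roles of the sides exchanged).  Product Bernoulli bond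
percolation `prodBernoulli w` on `Fin n`; a ROOT SIDE `R ∋ s` and two separating vertices `u, v ∉ R` (the memo's ports `x, y`) with no
positive pair from `R` to the outside of `R ∪ {u, v}`; `F` = the pairs meeting `R` (root-side pairs), `p ~_F q` = `ω ∩ F ∈ {p ↔ q}`.
A ROOT-SIDE target `t ∈ R ∪ {u, v}` and two OUTSIDE targets `b, c ∉ R`.  Root-side events: the port filters `Xu = {s ~_F u}`, `Xv = {s ~_F v}`
and their classes `KX = Xu ∖ Xv`, `KY = Xv ∖ Xu`, `KW = Xu ∩ Xv`, `K0 = (Xu ∪ Xv)ᶜ` (the memo's classes X, Y, XY, 0′); `Bt = {s ~_F t}`,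
`Vt = {v ~_F t}`, `Ut = {u ~_F t}`.  Outside events (determined by the pairs not meeting `R`): `Z = {u ↔ v in Rᶜ}`, `Pb = {u ↔ b in Rᶜ}`,
`Qb = {v ↔ b in Rᶜ}`, `Pc`, `Qc`.  Dictionary (gen 24): `{s ↔ t} = Bt ∪ (Z ∩ (Bt ∪ ((Xu ∩ Vt) ∪ (Xv ∩ Ut))))`,
`{s ↔ b} = (Pb ∩ Xu) ∪ (Qb ∩ Xv)` on the sure set.

* `real_outside_inter_twoLevel` — for an outside event `M` and root-side events `T₀ ⊆ T₁`:
  `P(M ∩ (T₀ ∪ (Z ∩ T₁))) = P(M)·P(T₀) + P(M ∩ Z)·(P(T₁) − P(T₀))`;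
* `real_classSplit` — `P(E) = P(E ∩ KX) + P(E ∩ KY) + P(E ∩ KW) + P(E ∩ K0)`;
* `twoCut_sahiE3_rootSide_eq` — **(R1), the reduced form of MODE B**: with the class law `qX, qY, qW`, the target numbers
  `u0, uX, uY, uW = P(Bt ∩ K·)`, the port-swap numbers `dX = P((Bt ∪ Vt) ∩ KX) − P(Bt ∩ KX)` ("`t` hangs at `v` while `s` is joined to `u` only"),
  `dY` likewise, the outside marginals `bx = P(Pb)`, `by = P(Qb)`, `bU = P(Pb ∪ Qb)`, `bN = P(Pb ∩ Qb)` (and for `c`), the outside pair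
  moments `mxx = P(Pb ∩ Pc)`, `myy`, `mU = P((Pb ∪ Qb) ∩ (Pc ∪ Qc))`, `mN = P(Pb ∩ Qb ∩ Pc ∩ Qc)` and `ζ = P(Z)`:
  `E₃({s↔t},{s↔b},{s↔c}) = −K·u0 + Φ_X·uX + Φ_Y·uY + Φ_XY·uW + Φ_D·(dX + dY)`,
  `P_b = qX·bx + qY·by + qW·bU`, `P_c` likewise, `P_bc = qX·mxx + qY·myy + qW·mU`, `K = P_bc − P_bP_c`,
  `Φ_X = 2mxx − bx·P_c − cx·P_b − K`, `Φ_Y = 2myy − by·P_c − cy·P_b − K`, `Φ_XY = 2mU − bU·P_c − cU·P_b − K`, `Φ_D = 2mN − bN·P_c − cN·P_b − ζK`.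
  Applied to `t = a` (the lone root-side target), `t = u` and `t = v` it gives the three terms of the assembly (B1) of THEOREM B⁺.
All events and reals are passed as variables with defining hypotheses (instantiate with `rfl`).
-/

noncomputable section

namespace Summit.CriticalPhenomena.PercolationContinuityZ3.Theorems

namespace IncStarTwoCut

open MeasureTheory Set Literature.Probability.Percolation Literature.Probability.LatticeModels
open IncStarOneTargetSide
open scoped Classical

variable {n : ℕ}

/-! ### Measure plumbing -/

/-- **An outside event against a two-level root-side event.**  For `M` determined by the pairs not meeting `R`, root-side events
`T₀ ⊆ T₁` and `Z = {u ↔ v in Rᶜ}`: `P(M ∩ (T₀ ∪ (Z ∩ T₁))) = P(M)·P(T₀) + P(M ∩ Z)·(P(T₁) − P(T₀))`. [this work] -/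
theorem real_outside_inter_twoLevel (w : Sym2 (Fin n) → unitInterval) (R : Set (Fin n)) (u v : Fin n)
    {M T₀ T₁ : Set (BondConfig (Fin n))} (hT : T₀ ⊆ T₁)
    (hM : DeterminedBy M {e : Sym2 (Fin n) | ∃ y ∈ R, y ∈ e}ᶜ)
    (h₀ : DeterminedBy T₀ {e : Sym2 (Fin n) | ∃ y ∈ R, y ∈ e}) (h₁ : DeterminedBy T₁ {e : Sym2 (Fin n) | ∃ y ∈ R, y ∈ e}) :
    (prodBernoulli w).real (M ∩ (T₀ ∪ (openConnIn Rᶜ u v ∩ T₁)))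
      = (prodBernoulli w).real M * (prodBernoulli w).real T₀
        + (prodBernoulli w).real (M ∩ openConnIn Rᶜ u v) * ((prodBernoulli w).real T₁ - (prodBernoulli w).real T₀) := by
  have hm : ∀ X : Set (BondConfig (Fin n)), MeasurableSet X := fun _ => MeasurableSet.of_discrete
  set Z : Set (BondConfig (Fin n)) := openConnIn Rᶜ u v
  have hset : M ∩ (T₀ ∪ (Z ∩ T₁)) = (M ∩ T₀) ∪ ((M ∩ Z) ∩ (T₁ \ T₀)) := by
    ext ω
    simp only [Set.mem_inter_iff, Set.mem_union, Set.mem_sdiff]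
    constructor
    · rintro ⟨hMω, h | ⟨hZ, h1⟩⟩
      · exact Or.inl ⟨hMω, h⟩
      · by_cases h0 : ω ∈ T₀
        · exact Or.inl ⟨hMω, h0⟩
        · exact Or.inr ⟨⟨hMω, hZ⟩, h1, h0⟩
    · rintro (⟨hMω, h⟩ | ⟨⟨hMω, hZ⟩, h1, -⟩)
      · exact ⟨hMω, Or.inl h⟩
      · exact ⟨hMω, Or.inr ⟨hZ, h1⟩⟩
  have hdisj : Disjoint (M ∩ T₀) ((M ∩ Z) ∩ (T₁ \ T₀)) := Set.disjoint_left.2 fun ω h h' => h'.2.2 h.2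
  have hdiff : (prodBernoulli w).real (T₁ \ T₀) = (prodBernoulli w).real T₁ - (prodBernoulli w).real T₀ := by
    have h := measureReal_inter_add_sdiff (μ := prodBernoulli w) (s := T₁) (hm T₀)
    rw [Set.inter_eq_self_of_subset_right hT] at h
    linarith
  have dZ : DeterminedBy Z {e : Sym2 (Fin n) | ∃ y ∈ R, y ∈ e}ᶜ := SahiRootSide.determinedBy_openConnIn_compl R u v
  rw [hset, measureReal_union hdisj (hm _), indep_near_far w R hM h₀,
    indep_near_far w R (hM.inter dZ) (determinedBy_union_sdiff h₁ h₀).2, hdiff]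

/-- **Splitting along the root's port classes**: `P(E) = P(E ∩ (Xu ∖ Xv)) + P(E ∩ (Xv ∖ Xu)) + P(E ∩ (Xu ∩ Xv)) + P(E ∩ (Xu ∪ Xv)ᶜ)`.
[folklore] -/
theorem real_classSplit {μ : Measure (BondConfig (Fin n))} [IsFiniteMeasure μ] (E Xu Xv : Set (BondConfig (Fin n))) :
    μ.real E = μ.real (E ∩ (Xu \ Xv)) + μ.real (E ∩ (Xv \ Xu)) + μ.real (E ∩ (Xu ∩ Xv)) + μ.real (E ∩ (Xu ∪ Xv)ᶜ) := by
  have hm : ∀ X : Set (BondConfig (Fin n)), MeasurableSet X := fun _ => MeasurableSet.of_discrete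
  have hset : E = ((E ∩ (Xu \ Xv)) ∪ (E ∩ (Xv \ Xu)) ∪ (E ∩ (Xu ∩ Xv))) ∪ (E ∩ (Xu ∪ Xv)ᶜ) := by
    ext ω
    simp only [Set.mem_union, Set.mem_inter_iff, Set.mem_sdiff, Set.mem_compl_iff]
    tauto
  have d1 : Disjoint (E ∩ (Xu \ Xv)) (E ∩ (Xv \ Xu)) := Set.disjoint_left.2 fun ω h h' => h.2.2 h'.2.1
  have d2 : Disjoint ((E ∩ (Xu \ Xv)) ∪ (E ∩ (Xv \ Xu))) (E ∩ (Xu ∩ Xv)) := Set.disjoint_left.2 fun ω h h' => by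
    rcases h with h | h
    · exact h.2.2 h'.2.2
    · exact h.2.2 h'.2.1
  have d3 : Disjoint (((E ∩ (Xu \ Xv)) ∪ (E ∩ (Xv \ Xu))) ∪ (E ∩ (Xu ∩ Xv))) (E ∩ (Xu ∪ Xv)ᶜ) :=
    Set.disjoint_left.2 fun ω h h' => by
      rcases h with (h | h) | h
      · exact h'.2 (Or.inl h.2.1)
      · exact h'.2 (Or.inr h.2.1)
      · exact h'.2 (Or.inl h.2.1)
  conv_lhs => rw [hset]
  rw [measureReal_union d3 (hm _), measureReal_union d2 (hm _), measureReal_union d1 (hm _)]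

/-! ### Set algebra on the classes -/

/-- On the class `KX = Xu ∖ Xv` an outside-target event `(P ∩ Xu) ∪ (Q ∩ Xv)` is `P`; on `KY` it is `Q`; on `KW = Xu ∩ Xv` it is
`P ∪ Q`; on `K0` it is empty. [this work] -/
theorem portMix_inter_classes {α : Type*} (P Q Xu Xv E : Set α) :
    ((P ∩ Xu) ∪ (Q ∩ Xv)) ∩ (E ∩ (Xu \ Xv)) = P ∩ (E ∩ (Xu \ Xv)) ∧
    ((P ∩ Xu) ∪ (Q ∩ Xv)) ∩ (E ∩ (Xv \ Xu)) = Q ∩ (E ∩ (Xv \ Xu)) ∧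
    ((P ∩ Xu) ∪ (Q ∩ Xv)) ∩ (E ∩ (Xu ∩ Xv)) = (P ∪ Q) ∩ (E ∩ (Xu ∩ Xv)) ∧
    ((P ∩ Xu) ∪ (Q ∩ Xv)) ∩ (E ∩ (Xu ∪ Xv)ᶜ) = ∅ := by
  refine ⟨?_, ?_, ?_, ?_⟩ <;> ext ω <;>
    simp only [Set.mem_inter_iff, Set.mem_union, Set.mem_sdiff, Set.mem_compl_iff, Set.mem_empty_iff_false, iff_false, not_and] <;>
    tauto

/-- The root-side target event `St = Bt ∪ (Z ∩ (Bt ∪ ((Xu ∩ Vt) ∪ (Xv ∩ Ut))))` on the classes: two-level on `KX` and `KY`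
(`(Bt ∩ K) ∪ (Z ∩ ((Bt ∪ Vt) ∩ K))` resp. with `Ut`), and plain `Bt` on `KW` (given `Xv ∩ Vt ⊆ Bt`, `Xu ∩ Ut ⊆ Bt`) and on `K0`. [this work] -/
theorem rootTarget_inter_classes {α : Type*} {Bt Vt Ut Xu Xv Z : Set α} (hVt : Xv ∩ Vt ⊆ Bt) (hUt : Xu ∩ Ut ⊆ Bt) (M : Set α) :
    M ∩ ((Bt ∪ (Z ∩ (Bt ∪ ((Xu ∩ Vt) ∪ (Xv ∩ Ut))))) ∩ (Xu \ Xv))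
      = M ∩ ((Bt ∩ (Xu \ Xv)) ∪ (Z ∩ ((Bt ∪ Vt) ∩ (Xu \ Xv)))) ∧
    M ∩ ((Bt ∪ (Z ∩ (Bt ∪ ((Xu ∩ Vt) ∪ (Xv ∩ Ut))))) ∩ (Xv \ Xu))
      = M ∩ ((Bt ∩ (Xv \ Xu)) ∪ (Z ∩ ((Bt ∪ Ut) ∩ (Xv \ Xu)))) ∧
    M ∩ ((Bt ∪ (Z ∩ (Bt ∪ ((Xu ∩ Vt) ∪ (Xv ∩ Ut))))) ∩ (Xu ∩ Xv)) = M ∩ (Bt ∩ (Xu ∩ Xv)) ∧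
    M ∩ ((Bt ∪ (Z ∩ (Bt ∪ ((Xu ∩ Vt) ∪ (Xv ∩ Ut))))) ∩ (Xu ∪ Xv)ᶜ) = M ∩ (Bt ∩ (Xu ∪ Xv)ᶜ) := by
  refine ⟨?_, ?_, ?_, ?_⟩ <;> ext ω <;>
    simp only [Set.mem_inter_iff, Set.mem_union, Set.mem_sdiff, Set.mem_compl_iff]
  · tauto
  · tauto
  · constructor
    · rintro ⟨hM, hS, hXu, hXv⟩
      refine ⟨hM, ?_, hXu, hXv⟩
      rcases hS with h | ⟨-, h | ⟨-, h⟩ | ⟨-, h⟩⟩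
      · exact h
      · exact h
      · exact hVt ⟨hXv, h⟩
      · exact hUt ⟨hXu, h⟩
    · rintro ⟨hM, hB, hXu, hXv⟩
      exact ⟨hM, Or.inl hB, hXu, hXv⟩
  · constructor
    · rintro ⟨hM, hS, hK⟩
      refine ⟨hM, ?_, hK⟩
      rcases hS with h | ⟨-, h | ⟨hXu, -⟩ | ⟨hXv, -⟩⟩
      · exact h
      · exact h
      · exact absurd (Or.inl hXu) hK
      · exact absurd (Or.inr hXv) hK
    · rintro ⟨hM, hB, hK⟩
      exact ⟨hM, Or.inl hB, hK⟩

/-! ### (R1): the reduced form of MODE B -/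

set_option maxHeartbeats 800000 in
/-- **(R1) — Sahi's `E₃` of the increasing star across a two-cut `{u, v}` with the root `s` and the target `t` on the root side and the
targets `b, c` outside.**  See the module docstring for the vocabulary; all events and reals are supplied through defining hypotheses.
[this work] -/
theorem twoCut_sahiE3_rootSide_eq (w : Sym2 (Fin n) → unitInterval) (R : Set (Fin n)) {s u v t b c : Fin n}
    (hs : s ∈ R) (ht : t ∈ R ∨ t = u ∨ t = v) (hb : b ∉ R) (hc : c ∉ R)
    (hw : ∀ x ∈ R, ∀ z, z ∉ R → z ≠ u → z ≠ v → w s(x, z) = 0)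
    {F : Set (Sym2 (Fin n))} (hF : F = {e : Sym2 (Fin n) | ∃ y ∈ R, y ∈ e})
    {Xu Xv Bt Vt Ut Pb Qb Pc Qc : Set (BondConfig (Fin n))}
    (hXu : Xu = {ω | ω ∩ F ∈ (openConn s u : Set (BondConfig (Fin n)))})
    (hXv : Xv = {ω | ω ∩ F ∈ (openConn s v : Set (BondConfig (Fin n)))})
    (hBt : Bt = {ω | ω ∩ F ∈ (openConn s t : Set (BondConfig (Fin n)))})
    (hVt : Vt = {ω | ω ∩ F ∈ (openConn v t : Set (BondConfig (Fin n)))})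
    (hUt : Ut = {ω | ω ∩ F ∈ (openConn u t : Set (BondConfig (Fin n)))})
    (hPb : Pb = openConnIn Rᶜ u b) (hQb : Qb = openConnIn Rᶜ v b) (hPc : Pc = openConnIn Rᶜ u c) (hQc : Qc = openConnIn Rᶜ v c)
    {ζ qX qY qW u0 uX uY uW dX dY bx by_ bU bN cx cy cU cN mxx myy mU mN : ℝ}
    (hζ : ζ = (prodBernoulli w).real (openConnIn Rᶜ u v))
    (hqX : qX = (prodBernoulli w).real (Xu \ Xv)) (hqY : qY = (prodBernoulli w).real (Xv \ Xu))
    (hqW : qW = (prodBernoulli w).real (Xu ∩ Xv))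
    (hu0 : u0 = (prodBernoulli w).real (Bt ∩ (Xu ∪ Xv)ᶜ)) (huX : uX = (prodBernoulli w).real (Bt ∩ (Xu \ Xv)))
    (huY : uY = (prodBernoulli w).real (Bt ∩ (Xv \ Xu))) (huW : uW = (prodBernoulli w).real (Bt ∩ (Xu ∩ Xv)))
    (hdX : dX = (prodBernoulli w).real ((Bt ∪ Vt) ∩ (Xu \ Xv)) - (prodBernoulli w).real (Bt ∩ (Xu \ Xv)))
    (hdY : dY = (prodBernoulli w).real ((Bt ∪ Ut) ∩ (Xv \ Xu)) - (prodBernoulli w).real (Bt ∩ (Xv \ Xu)))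
    (hbx : bx = (prodBernoulli w).real Pb) (hby : by_ = (prodBernoulli w).real Qb)
    (hbU : bU = (prodBernoulli w).real (Pb ∪ Qb)) (hbN : bN = (prodBernoulli w).real (Pb ∩ Qb))
    (hcx : cx = (prodBernoulli w).real Pc) (hcy : cy = (prodBernoulli w).real Qc)
    (hcU : cU = (prodBernoulli w).real (Pc ∪ Qc)) (hcN : cN = (prodBernoulli w).real (Pc ∩ Qc))
    (hmxx : mxx = (prodBernoulli w).real (Pb ∩ Pc)) (hmyy : myy = (prodBernoulli w).real (Qb ∩ Qc))
    (hmU : mU = (prodBernoulli w).real ((Pb ∪ Qb) ∩ (Pc ∪ Qc))) (hmN : mN = (prodBernoulli w).real ((Pb ∩ Qb) ∩ (Pc ∩ Qc))) :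
    sahiE3 (prodBernoulli w) (openConn s t) (openConn s b) (openConn s c)
      = -((qX * mxx + qY * myy + qW * mU) - (qX * bx + qY * by_ + qW * bU) * (qX * cx + qY * cy + qW * cU)) * u0
        + (2 * mxx - bx * (qX * cx + qY * cy + qW * cU) - cx * (qX * bx + qY * by_ + qW * bU)
            - ((qX * mxx + qY * myy + qW * mU) - (qX * bx + qY * by_ + qW * bU) * (qX * cx + qY * cy + qW * cU))) * uX
        + (2 * myy - by_ * (qX * cx + qY * cy + qW * cU) - cy * (qX * bx + qY * by_ + qW * bU)
            - ((qX * mxx + qY * myy + qW * mU) - (qX * bx + qY * by_ + qW * bU) * (qX * cx + qY * cy + qW * cU))) * uY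
        + (2 * mU - bU * (qX * cx + qY * cy + qW * cU) - cU * (qX * bx + qY * by_ + qW * bU)
            - ((qX * mxx + qY * myy + qW * mU) - (qX * bx + qY * by_ + qW * bU) * (qX * cx + qY * cy + qW * cU))) * uW
        + (2 * mN - bN * (qX * cx + qY * cy + qW * cU) - cN * (qX * bx + qY * by_ + qW * bU)
            - ζ * ((qX * mxx + qY * myy + qW * mU) - (qX * bx + qY * by_ + qW * bU) * (qX * cx + qY * cy + qW * cU)))
            * (dX + dY) := by
  subst hζ hqX hqY hqW hu0 huX huY huW hdX hdY hbx hby hbU hbN hcx hcy hcU hcN hmxx hmyy hmU hmN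
  subst hPb hQb hPc hQc
  subst hXu hXv hBt hVt hUt
  subst hF
  have hmeas : ∀ X : Set (BondConfig (Fin n)), MeasurableSet X := fun _ => MeasurableSet.of_discrete
  -- names
  set μ := prodBernoulli w with hμ
  set F : Set (Sym2 (Fin n)) := {e : Sym2 (Fin n) | ∃ y ∈ R, y ∈ e} with hFd
  set Xu : Set (BondConfig (Fin n)) := {ω | ω ∩ F ∈ (openConn s u : Set (BondConfig (Fin n)))} with hXud
  set Xv : Set (BondConfig (Fin n)) := {ω | ω ∩ F ∈ (openConn s v : Set (BondConfig (Fin n)))} with hXvd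
  set Bt : Set (BondConfig (Fin n)) := {ω | ω ∩ F ∈ (openConn s t : Set (BondConfig (Fin n)))} with hBtd
  set Vt : Set (BondConfig (Fin n)) := {ω | ω ∩ F ∈ (openConn v t : Set (BondConfig (Fin n)))} with hVtd
  set Ut : Set (BondConfig (Fin n)) := {ω | ω ∩ F ∈ (openConn u t : Set (BondConfig (Fin n)))} with hUtd
  set Z : Set (BondConfig (Fin n)) := openConnIn Rᶜ u v with hZd
  set Pb : Set (BondConfig (Fin n)) := openConnIn Rᶜ u b with hPbd
  set Qb : Set (BondConfig (Fin n)) := openConnIn Rᶜ v b with hQbd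
  set Pc : Set (BondConfig (Fin n)) := openConnIn Rᶜ u c with hPcd
  set Qc : Set (BondConfig (Fin n)) := openConnIn Rᶜ v c with hQcd
  set St : Set (BondConfig (Fin n)) := Bt ∪ (Z ∩ (Bt ∪ ((Xu ∩ Vt) ∪ (Xv ∩ Ut)))) with hSt
  set Sb : Set (BondConfig (Fin n)) := (Pb ∩ Xu) ∪ (Qb ∩ Xv) with hSb
  set Sc : Set (BondConfig (Fin n)) := (Pc ∩ Xu) ∪ (Qc ∩ Xv) with hSc
  set KX : Set (BondConfig (Fin n)) := Xu \ Xv with hKX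
  set KY : Set (BondConfig (Fin n)) := Xv \ Xu with hKY
  set KW : Set (BondConfig (Fin n)) := Xu ∩ Xv with hKW
  set K0 : Set (BondConfig (Fin n)) := (Xu ∪ Xv)ᶜ with hK0
  -- (0) the sure set and the dictionary
  set G : Set (BondConfig (Fin n)) := {ω | ∀ e, w e = 0 → e ∉ ω}
  have hG1 : μ.real G = 1 := IncStar.real_sureClosed w
  have hGω : ∀ ω ∈ G, ∀ x ∈ R, ∀ z, z ∉ R → z ≠ u → z ≠ v → s(x, z) ∉ ω :=
    fun ω hω x hx z hz hzu hzv => hω _ (hw x hx z hz hzu hzv)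
  have cT : ∀ ω ∈ G, (ω ∈ openConn s t ↔ ω ∈ St) := by
    intro ω hω
    rw [twoCut_conn_rootSide_iff hs (hGω ω hω) ht]
    simp only [hSt, Set.mem_union, Set.mem_inter_iff, Set.mem_setOf_eq, hZd, hXud, hXvd, hBtd, hVtd, hUtd]
    tauto
  have cOut : ∀ {a : Fin n} (ha : a ∉ R) (P Q : Set (BondConfig (Fin n))), P = openConnIn Rᶜ u a → Q = openConnIn Rᶜ v a →
      ∀ ω ∈ G, (ω ∈ openConn s a ↔ ω ∈ (P ∩ Xu) ∪ (Q ∩ Xv)) := by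
    rintro a ha P Q rfl rfl ω hω
    rw [twoCut_conn_outside_iff hs (hGω ω hω) ha]
    simp only [Set.mem_union, Set.mem_inter_iff, hXud, hXvd, Set.mem_setOf_eq]
    tauto
  have cB : ∀ ω ∈ G, (ω ∈ openConn s b ↔ ω ∈ Sb) := cOut hb Pb Qb rfl rfl
  have cC : ∀ ω ∈ G, (ω ∈ openConn s c ↔ ω ∈ Sc) := cOut hc Pc Qc rfl rfl
  rw [IncStar.sahiE3_congr_of_sure (hmeas G) hG1 cT cB cC, sahiE3_def]
  -- (1) locality
  have dF : ∀ p q : Fin n, DeterminedBy {ω : BondConfig (Fin n) | ω ∩ F ∈ (openConn p q : Set (BondConfig (Fin n)))} F :=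
    fun p q => SahiRootSide.determinedBy_rootSide R p q
  have dO : ∀ p q : Fin n, DeterminedBy (openConnIn Rᶜ p q : Set (BondConfig (Fin n))) Fᶜ :=
    fun p q => SahiRootSide.determinedBy_openConnIn_compl R p q
  have dXu : DeterminedBy Xu F := dF s u
  have dXv : DeterminedBy Xv F := dF s v
  have dBt : DeterminedBy Bt F := dF s t
  have dKX : DeterminedBy KX F := (determinedBy_union_sdiff dXu dXv).2
  have dKY : DeterminedBy KY F := (determinedBy_union_sdiff dXv dXu).2
  have dKW : DeterminedBy KW F := dXu.inter dXv
  have dK0 : DeterminedBy K0 F := by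
    have h := (determinedBy_union_sdiff (determinedBy_univ F) (determinedBy_union_sdiff dXu dXv).1).2
    rwa [← Set.compl_eq_univ_sdiff] at h
  have dPb : DeterminedBy Pb Fᶜ := dO u b
  have dQb : DeterminedBy Qb Fᶜ := dO v b
  have dPc : DeterminedBy Pc Fᶜ := dO u c
  have dQc : DeterminedBy Qc Fᶜ := dO v c
  have dBU : DeterminedBy (Pb ∪ Qb) Fᶜ := (determinedBy_union_sdiff dPb dQb).1
  have dCU : DeterminedBy (Pc ∪ Qc) Fᶜ := (determinedBy_union_sdiff dPc dQc).1
  -- (2) deterministic facts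
  have hVB : Xv ∩ Vt ⊆ Bt := fun ω h => by
    show (openGraph (ω ∩ F)).Reachable s t
    exact (show (openGraph (ω ∩ F)).Reachable s v from h.1).trans h.2
  have hUB : Xu ∩ Ut ⊆ Bt := fun ω h => by
    show (openGraph (ω ∩ F)).Reachable s t
    exact (show (openGraph (ω ∩ F)).Reachable s u from h.1).trans h.2
  have opf := fun (a : Fin n) (ω : BondConfig (Fin n)) => outside_ports_facts Rᶜ u v a ω
  have hPZ : ∀ {a : Fin n}, openConnIn Rᶜ u a ∩ Z = openConnIn Rᶜ u a ∩ openConnIn Rᶜ v a := fun {a} => by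
    ext ω; simp only [Set.mem_inter_iff]
    exact ⟨fun h => ⟨h.1, (opf a ω).2.1 h.2 h.1⟩, fun h => ⟨h.1, (opf a ω).1 h.1 h.2⟩⟩
  have hQZ : ∀ {a : Fin n}, openConnIn Rᶜ v a ∩ Z = openConnIn Rᶜ u a ∩ openConnIn Rᶜ v a := fun {a} => by
    ext ω; simp only [Set.mem_inter_iff]
    exact ⟨fun h => ⟨(opf a ω).2.2 h.2 h.1, h.1⟩, fun h => ⟨h.2, (opf a ω).1 h.1 h.2⟩⟩
  have hPPZ : (Pb ∩ Pc) ∩ Z = (Pb ∩ Qb) ∩ (Pc ∩ Qc) := by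
    ext ω; simp only [Set.mem_inter_iff]
    constructor
    · rintro ⟨⟨h1, h2⟩, hZ⟩
      exact ⟨⟨h1, (opf b ω).2.1 hZ h1⟩, h2, (opf c ω).2.1 hZ h2⟩
    · rintro ⟨⟨h1, h2⟩, h3, -⟩
      exact ⟨⟨h1, h3⟩, (opf b ω).1 h1 h2⟩
  have hQQZ : (Qb ∩ Qc) ∩ Z = (Pb ∩ Qb) ∩ (Pc ∩ Qc) := by
    ext ω; simp only [Set.mem_inter_iff]
    constructor
    · rintro ⟨⟨h1, h2⟩, hZ⟩
      exact ⟨⟨(opf b ω).2.2 hZ h1, h1⟩, (opf c ω).2.2 hZ h2, h2⟩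
    · rintro ⟨⟨h1, h2⟩, -, h4⟩
      exact ⟨⟨h2, h4⟩, (opf b ω).1 h1 h2⟩
  -- (3) rectangles: an outside event against a class, plain and through `St`
  have rect : ∀ {M K : Set (BondConfig (Fin n))}, DeterminedBy M Fᶜ → DeterminedBy K F →
      μ.real (M ∩ K) = μ.real M * μ.real K := fun hM hK => indep_near_far w R hM hK
  have sTX : ∀ M : Set (BondConfig (Fin n)), DeterminedBy M Fᶜ →
      μ.real (M ∩ (St ∩ KX)) = μ.real M * μ.real (Bt ∩ KX) + μ.real (M ∩ Z) * (μ.real ((Bt ∪ Vt) ∩ KX) - μ.real (Bt ∩ KX)) := by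
    intro M hM
    rw [(rootTarget_inter_classes hVB hUB M).1]
    exact real_outside_inter_twoLevel w R u v (Set.inter_subset_inter_left _ Set.subset_union_left) hM (dBt.inter dKX)
      (((determinedBy_union_sdiff dBt (dF v t)).1).inter dKX)
  have sTY : ∀ M : Set (BondConfig (Fin n)), DeterminedBy M Fᶜ →
      μ.real (M ∩ (St ∩ KY)) = μ.real M * μ.real (Bt ∩ KY) + μ.real (M ∩ Z) * (μ.real ((Bt ∪ Ut) ∩ KY) - μ.real (Bt ∩ KY)) := by
    intro M hM
    rw [(rootTarget_inter_classes hVB hUB M).2.1]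
    exact real_outside_inter_twoLevel w R u v (Set.inter_subset_inter_left _ Set.subset_union_left) hM (dBt.inter dKY)
      (((determinedBy_union_sdiff dBt (dF u t)).1).inter dKY)
  have sTW : ∀ M : Set (BondConfig (Fin n)), DeterminedBy M Fᶜ → μ.real (M ∩ (St ∩ KW)) = μ.real M * μ.real (Bt ∩ KW) := by
    intro M hM
    rw [(rootTarget_inter_classes hVB hUB M).2.2.1]
    exact rect hM (dBt.inter dKW)
  have sT0 : ∀ M : Set (BondConfig (Fin n)), DeterminedBy M Fᶜ → μ.real (M ∩ (St ∩ K0)) = μ.real M * μ.real (Bt ∩ K0) := by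
    intro M hM
    rw [(rootTarget_inter_classes hVB hUB M).2.2.2]
    exact rect hM (dBt.inter dK0)
  have one_real : μ.real (Set.univ : Set (BondConfig (Fin n))) = 1 := by rw [hμ]; exact probReal_univ
  have dU : DeterminedBy (Set.univ : Set (BondConfig (Fin n))) Fᶜ := determinedBy_univ _
  -- (4) the seven moments, class by class
  -- P(St)
  have mT : μ.real St
      = (μ.real (Bt ∩ KX) + μ.real Z * (μ.real ((Bt ∪ Vt) ∩ KX) - μ.real (Bt ∩ KX)))
        + (μ.real (Bt ∩ KY) + μ.real Z * (μ.real ((Bt ∪ Ut) ∩ KY) - μ.real (Bt ∩ KY)))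
        + μ.real (Bt ∩ KW) + μ.real (Bt ∩ K0) := by
    rw [real_classSplit St Xu Xv]
    have h1 := sTX Set.univ dU; have h2 := sTY Set.univ dU; have h3 := sTW Set.univ dU; have h4 := sT0 Set.univ dU
    simp only [Set.univ_inter, one_real, one_mul] at h1 h2 h3 h4
    rw [h1, h2, h3, h4]
  -- P(Sb), P(Sc), P(Sb ∩ Sc)
  have mixB := portMix_inter_classes Pb Qb Xu Xv (Set.univ : Set (BondConfig (Fin n)))
  have mixC := portMix_inter_classes Pc Qc Xu Xv (Set.univ : Set (BondConfig (Fin n)))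
  simp only [Set.univ_inter] at mixB mixC
  have mB : μ.real Sb = μ.real Pb * μ.real KX + μ.real Qb * μ.real KY + μ.real (Pb ∪ Qb) * μ.real KW := by
    rw [real_classSplit Sb Xu Xv, mixB.1, mixB.2.1, mixB.2.2.1, mixB.2.2.2, measureReal_empty, add_zero,
      rect dPb dKX, rect dQb dKY, rect dBU dKW]
  have mC : μ.real Sc = μ.real Pc * μ.real KX + μ.real Qc * μ.real KY + μ.real (Pc ∪ Qc) * μ.real KW := by
    rw [real_classSplit Sc Xu Xv, mixC.1, mixC.2.1, mixC.2.2.1, mixC.2.2.2, measureReal_empty, add_zero,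
      rect dPc dKX, rect dQc dKY, rect dCU dKW]
  have hBC : ∀ K : Set (BondConfig (Fin n)), Sb ∩ Sc ∩ K = Sb ∩ (Sc ∩ K) := fun K => Set.inter_assoc _ _ _
  have mBC : μ.real (Sb ∩ Sc) = μ.real (Pb ∩ Pc) * μ.real KX + μ.real (Qb ∩ Qc) * μ.real KY
      + μ.real ((Pb ∪ Qb) ∩ (Pc ∪ Qc)) * μ.real KW := by
    rw [real_classSplit (Sb ∩ Sc) Xu Xv, hBC, hBC, hBC, hBC, mixC.1, mixC.2.1, mixC.2.2.1, mixC.2.2.2, Set.inter_empty,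
      measureReal_empty, add_zero]
    have e1 := (portMix_inter_classes Pb Qb Xu Xv Pc).1
    have e2 := (portMix_inter_classes Pb Qb Xu Xv Qc).2.1
    have e3 := (portMix_inter_classes Pb Qb Xu Xv (Pc ∪ Qc)).2.2.1
    rw [e1, e2, e3, ← Set.inter_assoc, ← Set.inter_assoc, ← Set.inter_assoc,
      rect (dPb.inter dPc) dKX, rect (dQb.inter dQc) dKY, rect (dBU.inter dCU) dKW]
  -- P(Sb ∩ St), P(Sc ∩ St), P(Sb ∩ Sc ∩ St)
  have mixTB := portMix_inter_classes Pb Qb Xu Xv St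
  have mixTC := portMix_inter_classes Pc Qc Xu Xv St
  have mTB : μ.real (St ∩ Sb)
      = (μ.real Pb * μ.real (Bt ∩ KX) + μ.real (Pb ∩ Qb) * (μ.real ((Bt ∪ Vt) ∩ KX) - μ.real (Bt ∩ KX)))
        + (μ.real Qb * μ.real (Bt ∩ KY) + μ.real (Pb ∩ Qb) * (μ.real ((Bt ∪ Ut) ∩ KY) - μ.real (Bt ∩ KY)))
        + μ.real (Pb ∪ Qb) * μ.real (Bt ∩ KW) := by
    rw [Set.inter_comm St Sb, real_classSplit (Sb ∩ St) Xu Xv, Set.inter_assoc, Set.inter_assoc, Set.inter_assoc, Set.inter_assoc,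
      mixTB.1, mixTB.2.1, mixTB.2.2.1, mixTB.2.2.2, measureReal_empty, add_zero,
      sTX Pb dPb, sTY Qb dQb, sTW (Pb ∪ Qb) dBU, hPZ, hQZ]
  have mTC : μ.real (St ∩ Sc)
      = (μ.real Pc * μ.real (Bt ∩ KX) + μ.real (Pc ∩ Qc) * (μ.real ((Bt ∪ Vt) ∩ KX) - μ.real (Bt ∩ KX)))
        + (μ.real Qc * μ.real (Bt ∩ KY) + μ.real (Pc ∩ Qc) * (μ.real ((Bt ∪ Ut) ∩ KY) - μ.real (Bt ∩ KY)))
        + μ.real (Pc ∪ Qc) * μ.real (Bt ∩ KW) := by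
    rw [Set.inter_comm St Sc, real_classSplit (Sc ∩ St) Xu Xv, Set.inter_assoc, Set.inter_assoc, Set.inter_assoc, Set.inter_assoc,
      mixTC.1, mixTC.2.1, mixTC.2.2.1, mixTC.2.2.2, measureReal_empty, add_zero,
      sTX Pc dPc, sTY Qc dQc, sTW (Pc ∪ Qc) dCU, hPZ, hQZ]
  have mTBC : μ.real (St ∩ Sb ∩ Sc)
      = (μ.real (Pb ∩ Pc) * μ.real (Bt ∩ KX) + μ.real ((Pb ∩ Qb) ∩ (Pc ∩ Qc)) * (μ.real ((Bt ∪ Vt) ∩ KX) - μ.real (Bt ∩ KX)))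
        + (μ.real (Qb ∩ Qc) * μ.real (Bt ∩ KY) + μ.real ((Pb ∩ Qb) ∩ (Pc ∩ Qc)) * (μ.real ((Bt ∪ Ut) ∩ KY) - μ.real (Bt ∩ KY)))
        + μ.real ((Pb ∪ Qb) ∩ (Pc ∪ Qc)) * μ.real (Bt ∩ KW) := by
    have hset : St ∩ Sb ∩ Sc = Sb ∩ (Sc ∩ St) := by
      ext ω; simp only [Set.mem_inter_iff]; tauto
    rw [hset, real_classSplit (Sb ∩ (Sc ∩ St)) Xu Xv]
    simp only [Set.inter_assoc]
    rw [mixTC.1, mixTC.2.1, mixTC.2.2.1, mixTC.2.2.2, Set.inter_empty, measureReal_empty, add_zero]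
    have e1 := (portMix_inter_classes Pb Qb Xu Xv (Pc ∩ St)).1
    have e2 := (portMix_inter_classes Pb Qb Xu Xv (Qc ∩ St)).2.1
    have e3 := (portMix_inter_classes Pb Qb Xu Xv ((Pc ∪ Qc) ∩ St)).2.2.1
    simp only [Set.inter_assoc] at e1 e2 e3
    rw [e1, e2, e3, ← Set.inter_assoc Pb Pc, ← Set.inter_assoc Qb Qc, ← Set.inter_assoc (Pb ∪ Qb) (Pc ∪ Qc),
      sTX (Pb ∩ Pc) (dPb.inter dPc), sTY (Qb ∩ Qc) (dQb.inter dQc), sTW ((Pb ∪ Qb) ∩ (Pc ∪ Qc)) (dBU.inter dCU), hPPZ, hQQZ]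
    simp only [Set.inter_assoc]
  -- (5) assemble
  rw [mTBC, mTB, mTC, mBC, mT, mB, mC]
  ring

end IncStarTwoCut

end Summit.CriticalPhenomena.PercolationContinuityZ3.Theorems
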